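import Summits.ABC.ABC.Theorems.TwistAmplificationSharpModerateLawCoreLocalMinimality

/-!
# Crux `TwistAmplification.SharpModerateLaw` (stmt-ABC-1975), line `unit-plane-conic-two-torsion`:
the inverse dictionary `CoreLaw → CoreLawIF`, II — the descaled cusp image of a datum

Support file (`--supports stmt-ABC-1975`, stub `stub_ringCensus`, wave 2; the stub itself stays open), second of
three.  A datum `q ∈ ifShell F X Y` of a MAXIMAL form `F` goes to the pair `x' = (16·H_F(q), −32·G_F(q))`:
`x'.1³ − x'.2² = 1024(4H³ − G²) = 27648·Disc F·F(q)²` (Cayley's syzygy), `Mcusp x' = 16·Mplus F q`, `N5cusp x' = N5 F q`,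
and `x'` is tower-free at every `p ≥ 5` (`data_tf_five`, `…CoreLocalMinimality.lean`).  At `2` and `3` it need not
be; DESCALING repairs this:

* `descale_prime` — one-prime descaling of depth `2`: from `¬(p^{α+8} ∣ A ∧ p^{β+12} ∣ B)` there is `s ≤ 2` with
  `A = p^{4s}A'`, `B = p^{6s}B'`, `(A', B')` tower-free at `p`, and the previous stage non-tower-free;
* `exists_cusp_image`, **`data_cusp_image`** (registered sub-goal) — descaling `x'` at `2` (fed by
  `data_descale_two`, thresholds `(8, 11)`) and then at `3` (`data_descale_three`, thresholds `(5, 9)`) gives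
  `x″ = (x'.1/k⁴, x'.2/k⁶)`, `k = 2^s3^t`, `s, t ≤ 2`, tower-free, with `c₄³ − c₆² = 1728·16W` and
  `Disc F·F(q)² = k¹²W` (the non-tower-freeness of the previous stages gives `2^{12s}·3^{12t+3} ∣ 4H³ − G²`), so
  `k¹²·Mcusp x″ = 16·Mplus F q` and `N5cusp x″ = N5 F q` (the primes `≥ 5` of `16W` and of `D·F(q)` agree, and
  `p ∣ x″.1 ⟺ p ∣ H_F(q)`): `x″ ∈ cuspShell X (16Y/k¹²)`, one of nine levels.
-/

noncomputable section

-- the mandated summit namespace `Summit.ABC.ABC` (summit = problem) trips the duplicate-namespace linter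
set_option linter.dupNamespace false

namespace Summit.ABC.ABC.Theorems.SharpModerateLaw

open Literature.NumberTheory.CubicFields BinaryCubic
open scoped BigOperators

/-! ## 4. The cusp image of a datum: descaling at `2` and `3` -/

/-- `x = p^m·y`, `p^n ∣ y` give `p^{m+n} ∣ x`. -/
theorem pow_add_dvd_of_eq {p x y : ℤ} {m n : ℕ} (hx : x = p ^ m * y) (hy : p ^ n ∣ y) : p ^ (m + n) ∣ x := by
  rw [hx, pow_add]; exact mul_dvd_mul_left _ hy

/-- **One-prime descaling of depth `2`.** From `¬(p^{α+8} ∣ A ∧ p^{β+12} ∣ B)` (`α ≥ 4`, `β ≥ 6`) there is `s ≤ 2`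
with `A = p^{4s}A'`, `B = p^{6s}B'`, `(A', B')` tower-free at `p` (`¬(p^α ∣ A' ∧ p^β ∣ B')`), and for `s ≥ 1` the
previous stage non-tower-free (`p^{α+4s−4} ∣ A`, `p^{β+6s−6} ∣ B`). -/
theorem descale_prime (p : ℤ) {α β : ℕ} (hα : 4 ≤ α) (hβ : 6 ≤ β) (A B : ℤ)
    (h : ¬ (p ^ (α + 8) ∣ A ∧ p ^ (β + 12) ∣ B)) :
    ∃ s : ℕ, s ≤ 2 ∧ ∃ A' B' : ℤ, A = p ^ (4 * s) * A' ∧ B = p ^ (6 * s) * B' ∧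
      ¬ (p ^ α ∣ A' ∧ p ^ β ∣ B') ∧ (s = 0 ∨ (p ^ (α + 4 * s - 4) ∣ A ∧ p ^ (β + 6 * s - 6) ∣ B)) := by
  by_cases h0 : p ^ α ∣ A ∧ p ^ β ∣ B
  · by_cases h1 : p ^ (α + 4) ∣ A ∧ p ^ (β + 6) ∣ B
    · obtain ⟨⟨A₂, hA⟩, ⟨B₂, hB⟩⟩ := h1
      have eA : A = p ^ (4 * 2) * (p ^ (α - 4) * A₂) := by
        rw [hA, ← mul_assoc, ← pow_add]; congr 2; omega
      have eB : B = p ^ (6 * 2) * (p ^ (β - 6) * B₂) := by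
        rw [hB, ← mul_assoc, ← pow_add]; congr 2; omega
      refine ⟨2, le_rfl, _, _, eA, eB, ?_, Or.inr ⟨?_, ?_⟩⟩
      · rintro ⟨hA', hB'⟩
        refine h ⟨?_, ?_⟩
        · rw [show α + 8 = 4 * 2 + α by omega]; exact pow_add_dvd_of_eq eA hA'
        · rw [show β + 12 = 6 * 2 + β by omega]; exact pow_add_dvd_of_eq eB hB'
      · rw [show α + 4 * 2 - 4 = α + 4 by omega]; exact ⟨A₂, hA⟩
      · rw [show β + 6 * 2 - 6 = β + 6 by omega]; exact ⟨B₂, hB⟩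
    · obtain ⟨⟨A₁, hA⟩, ⟨B₁, hB⟩⟩ := h0
      have eA : A = p ^ (4 * 1) * (p ^ (α - 4) * A₁) := by
        rw [hA, ← mul_assoc, ← pow_add]; congr 2; omega
      have eB : B = p ^ (6 * 1) * (p ^ (β - 6) * B₁) := by
        rw [hB, ← mul_assoc, ← pow_add]; congr 2; omega
      refine ⟨1, by norm_num, _, _, eA, eB, ?_, Or.inr ⟨?_, ?_⟩⟩
      · rintro ⟨hA', hB'⟩
        refine h1 ⟨?_, ?_⟩
        · rw [show α + 4 = 4 * 1 + α by omega]; exact pow_add_dvd_of_eq eA hA'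
        · rw [show β + 6 = 6 * 1 + β by omega]; exact pow_add_dvd_of_eq eB hB'
      · rw [show α + 4 * 1 - 4 = α by omega]; exact ⟨A₁, hA⟩
      · rw [show β + 6 * 1 - 6 = β by omega]; exact ⟨B₁, hB⟩
  · exact ⟨0, by norm_num, A, B, by simp, by simp, h0, Or.inl rfl⟩

/-- A prime `p ≥ 5` does not divide `2^a·3^b`. -/
theorem not_dvd_two_pow_mul_three_pow {p : ℕ} (hp : p.Prime) (hp5 : 5 ≤ p) (a b : ℕ) :
    ¬ (p : ℤ) ∣ 2 ^ a * 3 ^ b := by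
  have hp' : Prime (p : ℤ) := Nat.prime_iff_prime_int.mp hp
  intro h
  rcases hp'.dvd_or_dvd h with h | h
  · have := Int.le_of_dvd (by norm_num) (hp'.dvd_of_dvd_pow h); omega
  · have := Int.le_of_dvd (by norm_num) (hp'.dvd_of_dvd_pow h); omega

/-- **The cusp image of a datum.** For `F` maximal and `q ∈ ifShell F X Y` there are `s, t ≤ 2` and a pair
`x″ = (c₄, c₆)` with `16·H_F(q) = k⁴c₄`, `−32·G_F(q) = k⁶c₆`, `k = 2^s3^t`, and `x″ ∈ cuspShell X (16Y/k¹²)`: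
descale `(16H, −32G)` at `2` and then at `3` (`descale_prime`, fed by `data_descale_two/three`); the result is
tower-free (`data_tf_five` at `p ≥ 5`), `c₄³ − c₆² = 1728·16W` with `Disc F·F(q)² = k¹²W` (Cayley's syzygy and the
non-tower-freeness of the previous descaling stages), so `Mcusp x″ = 16·Mplus F q/k¹²` and `N5cusp x″ = N5 F q`. -/
theorem exists_cusp_image {F : BinaryCubic ℤ} (hF : RingOfForm.IsMaximal F) {X Y : ℝ} {q : ℤ × ℤ}
    (hq : q ∈ ifShell F X Y) :
    ∃ ij ∈ Finset.range 3 ×ˢ Finset.range 3, ∃ x : ℤ × ℤ,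
      16 * hessAt F q.1 q.2 = ((2 : ℤ) ^ ij.1 * 3 ^ ij.2) ^ 4 * x.1 ∧
      -32 * covAt F q.1 q.2 = ((2 : ℤ) ^ ij.1 * 3 ^ ij.2) ^ 6 * x.2 ∧
      x ∈ cuspShell X (16 * Y / ((2 : ℝ) ^ ij.1 * 3 ^ ij.2) ^ 12) := by
  obtain ⟨hF0, hH0, hG0, ⟨hc5, hc2, hc3⟩, hYle, hYlt, hN⟩ := hq
  have hD0 : F.disc ≠ 0 := hF.disc_ne_zero
  set H : ℤ := hessAt F q.1 q.2 with hHdef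
  set G : ℤ := covAt F q.1 q.2 with hGdef
  set A₀ : ℤ := 16 * H with hA₀
  set B₀ : ℤ := -32 * G with hB₀
  have hsyz : G ^ 2 + 27 * F.disc * F.eval q.1 q.2 ^ 2 = 4 * H ^ 3 := syzygy F q.1 q.2
  -- descale at `2`
  have h2 : ¬ ((2 : ℤ) ^ (8 + 8) ∣ A₀ ∧ (2 : ℤ) ^ (11 + 12) ∣ B₀) := by
    rintro ⟨hA, hB⟩
    rw [hB₀, neg_mul, dvd_neg] at hB
    exact data_descale_two F hF q hF0 hc2 ⟨hA, hB⟩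
  obtain ⟨s, hs, A₁, B₁, hA₁, hB₁, hTF₂, hprev₂⟩ := descale_prime 2 (by norm_num) (by norm_num) A₀ B₀ h2
  -- descale at `3`
  have h3 : ¬ ((3 : ℤ) ^ (5 + 8) ∣ A₁ ∧ (3 : ℤ) ^ (9 + 12) ∣ B₁) := by
    rintro ⟨hA, hB⟩
    have hB' : (3 : ℤ) ^ (9 + 12) ∣ B₀ := hB.trans (Dvd.intro_left _ hB₁.symm)
    rw [hB₀, neg_mul, dvd_neg] at hB'
    exact data_descale_three F hF q hF0 hc3 ⟨hA.trans (Dvd.intro_left _ hA₁.symm), hB'⟩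
  obtain ⟨t, ht, A₂, B₂, hA₂, hB₂, hTF₃, hprev₃⟩ := descale_prime 3 (by norm_num) (by norm_num) A₁ B₁ h3
  set k : ℤ := 2 ^ s * 3 ^ t with hk
  have hk0 : (0 : ℤ) < k := by positivity
  have hA : A₀ = k ^ 4 * A₂ := by rw [hA₁, hA₂, hk]; ring
  have hB : B₀ = k ^ 6 * B₂ := by rw [hB₁, hB₂, hk]; ring
  have hA₂A₀ : A₂ ∣ A₀ := Dvd.intro_left _ hA.symm
  have hB₂B₀ : B₂ ∣ B₀ := Dvd.intro_left _ hB.symm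
  -- `2^{12s}·3^{12t+3} ∣ 4H³ − G²`
  have h2s : (2 : ℤ) ^ (12 * s) ∣ 4 * H ^ 3 - G ^ 2 := by
    rcases hprev₂ with rfl | ⟨hpa, hpb⟩
    · simp
    · have ha : (2 : ℤ) ^ (4 * s) ∣ H := by
        rw [show 8 + 4 * s - 4 = 4 + 4 * s by omega, pow_add, hA₀] at hpa
        exact (mul_dvd_mul_iff_left (by norm_num)).mp hpa
      have hb : (2 : ℤ) ^ (6 * s) ∣ G := by
        rw [show 11 + 6 * s - 6 = 5 + 6 * s by omega, pow_add, hB₀, neg_mul, dvd_neg] at hpb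
        exact (mul_dvd_mul_iff_left (by norm_num)).mp hpb
      refine dvd_sub (dvd_mul_of_dvd_right ?_ _) ?_
      · rw [show 12 * s = 4 * s * 3 by ring, pow_mul]; exact pow_dvd_pow_of_dvd ha 3
      · rw [show 12 * s = 6 * s * 2 by ring, pow_mul]; exact pow_dvd_pow_of_dvd hb 2
  have h3t : (3 : ℤ) ^ (12 * t + 3) ∣ 4 * H ^ 3 - G ^ 2 := by
    rcases hprev₃ with rfl | ⟨hpa, hpb⟩
    · rw [show 4 * H ^ 3 - G ^ 2 = 27 * (F.disc * F.eval q.1 q.2 ^ 2) by linear_combination (-1 : ℤ) * hsyz]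
      exact Dvd.intro _ rfl
    · have h16 : IsCoprime ((3 : ℤ) ^ (4 * t + 1)) 16 := by
        rw [show (16 : ℤ) = 2 ^ 4 by norm_num]; exact IsCoprime.pow ⟨1, -1, by norm_num⟩
      have h32 : IsCoprime ((3 : ℤ) ^ (6 * t + 3)) 32 := by
        rw [show (32 : ℤ) = 2 ^ 5 by norm_num]; exact IsCoprime.pow ⟨1, -1, by norm_num⟩
      have ha : (3 : ℤ) ^ (4 * t + 1) ∣ H := by
        rw [show 5 + 4 * t - 4 = 4 * t + 1 by omega] at hpa
        exact h16.dvd_of_dvd_mul_left ((hpa.trans (Dvd.intro_left _ hA₁.symm)).trans (by rw [hA₀]))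
      have hb : (3 : ℤ) ^ (6 * t + 3) ∣ G := by
        rw [show 9 + 6 * t - 6 = 6 * t + 3 by omega] at hpb
        have hb' : (3 : ℤ) ^ (6 * t + 3) ∣ B₀ := hpb.trans (Dvd.intro_left _ hB₁.symm)
        rw [hB₀, neg_mul, dvd_neg] at hb'
        exact h32.dvd_of_dvd_mul_left hb'
      refine dvd_sub (dvd_mul_of_dvd_right ?_ _) ((pow_dvd_pow _ (by omega : 12 * t + 3 ≤ (6 * t + 3) * 2)).trans ?_)
      · rw [show 12 * t + 3 = (4 * t + 1) * 3 by ring, pow_mul]; exact pow_dvd_pow_of_dvd ha 3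
      · rw [pow_mul]; exact pow_dvd_pow_of_dvd hb 2
  have hcop : IsCoprime ((2 : ℤ) ^ (12 * s)) ((3 : ℤ) ^ (12 * t + 3)) := IsCoprime.pow ⟨-1, 1, by norm_num⟩
  obtain ⟨W, hW⟩ := hcop.mul_dvd h2s h3t
  have hW' : 4 * H ^ 3 - G ^ 2 = 27 * k ^ 12 * W := by rw [hW, hk]; ring
  have hDF : F.disc * F.eval q.1 q.2 ^ 2 = k ^ 12 * W := by
    have : (27 : ℤ) * (F.disc * F.eval q.1 q.2 ^ 2) = 27 * (k ^ 12 * W) := by linear_combination hsyz + hW'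
    exact mul_left_cancel₀ (by norm_num) this
  have hW0 : W ≠ 0 := by
    intro h
    rw [h, mul_zero] at hDF
    exact mul_ne_zero hD0 (pow_ne_zero 2 hF0) hDF
  have hΔ : A₂ ^ 3 - B₂ ^ 2 = 1728 * (16 * W) := by
    have e1 : A₀ ^ 3 - B₀ ^ 2 = 1024 * (4 * H ^ 3 - G ^ 2) := by rw [hA₀, hB₀]; ring
    rw [hW', hA, hB] at e1
    have e2 : k ^ 12 * (A₂ ^ 3 - B₂ ^ 2) = k ^ 12 * (1728 * (16 * W)) := by linear_combination e1
    exact mul_left_cancel₀ (pow_ne_zero 12 hk0.ne') e2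
  have hΔ' : (A₂ ^ 3 - B₂ ^ 2) / 1728 = 16 * W := by rw [hΔ]; exact Int.mul_ediv_cancel_left _ (by norm_num)
  have hA₂0 : A₂ ≠ 0 := by
    intro h; apply hH0
    have : A₀ = 0 := by rw [hA, h, mul_zero]
    rw [hA₀] at this
    exact (mul_eq_zero.mp this).resolve_left (by norm_num)
  have hB₂0 : B₂ ≠ 0 := by
    intro h; apply hG0
    have : B₀ = 0 := by rw [hB, h, mul_zero]
    rw [hB₀] at this
    exact (mul_eq_zero.mp this).resolve_left (by norm_num)
  -- the level: `k¹²·Mcusp x″ = 16·Mplus F q`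
  have hM : k.natAbs ^ 12 * Mcusp (A₂, B₂) = 16 * Mplus F q := by
    unfold Mcusp Mplus
    simp only []
    rw [hΔ', hDF, ← Nat.mul_max_mul_left, ← Nat.mul_max_mul_left]
    have e1 : 16 * (256 * H.natAbs ^ 3) = k.natAbs ^ 12 * A₂.natAbs ^ 3 := by
      have h3 : (16 * H) ^ 3 = k ^ 12 * A₂ ^ 3 := by rw [← hA₀, hA]; ring
      have h3' := congrArg Int.natAbs h3
      simp only [Int.natAbs_mul, Int.natAbs_pow] at h3'
      have h16 : (16 : ℤ).natAbs = 16 := rfl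
      rw [h16] at h3'
      linarith
    have e2 : 16 * (k ^ 12 * W).natAbs = k.natAbs ^ 12 * (16 * W).natAbs := by
      simp only [Int.natAbs_mul, Int.natAbs_pow]
      rw [show (16 : ℤ).natAbs = 16 from rfl]; ring
    rw [e1, e2]
  -- real form of the level identity
  set kR : ℝ := ((2 : ℝ) ^ s * 3 ^ t) ^ 12 with hkR
  have hkR0 : 0 < kR := by positivity
  have hkcast : ((k.natAbs ^ 12 : ℕ) : ℝ) = kR := by
    rw [Nat.cast_pow, Nat.cast_natAbs, Int.cast_abs, abs_of_pos (by exact_mod_cast hk0), hk]; push_cast; ring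
  have hMR : (Mcusp (A₂, B₂) : ℝ) * kR = 16 * (Mplus F q : ℝ) := by
    have := congrArg (fun n : ℕ => (n : ℝ)) hM
    simp only [Nat.cast_mul] at this
    rw [hkcast] at this
    push_cast at this ⊢
    linarith
  -- the conductor proxy
  have hN5 : N5cusp (A₂, B₂) = N5 F q := by
    have hDF0 : F.disc * F.eval q.1 q.2 ≠ 0 := mul_ne_zero hD0 hF0
    unfold N5cusp N5
    simp only []
    rw [hΔ']
    have hset : ((16 * W).natAbs.primeFactors.filter (5 ≤ ·)) =
        ((F.disc * F.eval q.1 q.2).natAbs.primeFactors.filter (5 ≤ ·)) := by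
      ext p
      simp only [Finset.mem_filter, Nat.mem_primeFactors]
      constructor
      · rintro ⟨⟨hp, hdvd, -⟩, h5⟩
        have hp' : Prime (p : ℤ) := Nat.prime_iff_prime_int.mp hp
        refine ⟨⟨hp, ?_, Int.natAbs_ne_zero.mpr hDF0⟩, h5⟩
        have h1 : (p : ℤ) ∣ 16 * W := Int.ofNat_dvd_left.mpr hdvd
        have h2 : (p : ℤ) ∣ W := by
          rcases hp'.dvd_or_dvd h1 with h | h
          · exact absurd (by simpa using h) (not_dvd_two_pow_mul_three_pow hp h5 4 0)
          · exact h
        have h3 : (p : ℤ) ∣ F.disc * F.eval q.1 q.2 ^ 2 := by rw [hDF]; exact dvd_mul_of_dvd_right h2 _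
        have h4 : (p : ℤ) ∣ F.disc * F.eval q.1 q.2 := by
          rcases hp'.dvd_or_dvd h3 with h | h
          · exact dvd_mul_of_dvd_left h _
          · exact dvd_mul_of_dvd_right (hp'.dvd_of_dvd_pow h) _
        exact Int.ofNat_dvd_left.mp h4
      · rintro ⟨⟨hp, hdvd, -⟩, h5⟩
        have hp' : Prime (p : ℤ) := Nat.prime_iff_prime_int.mp hp
        refine ⟨⟨hp, ?_, Int.natAbs_ne_zero.mpr (mul_ne_zero (by norm_num) hW0)⟩, h5⟩
        have h1 : (p : ℤ) ∣ F.disc * F.eval q.1 q.2 := Int.ofNat_dvd_left.mpr hdvd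
        have h2 : (p : ℤ) ∣ k ^ 12 * W := by
          rw [← hDF, pow_two, ← mul_assoc]; exact dvd_mul_of_dvd_left h1 _
        have h3 : (p : ℤ) ∣ W := by
          rcases hp'.dvd_or_dvd h2 with h | h
          · exact absurd (by rw [hk] at h; simpa [mul_pow, ← pow_mul] using hp'.dvd_of_dvd_pow h)
              (not_dvd_two_pow_mul_three_pow hp h5 s t)
          · exact h
        exact Int.ofNat_dvd_left.mp (dvd_mul_of_dvd_right h3 _)
    rw [hset]
    refine Finset.prod_congr rfl fun p hp => ?_
    obtain ⟨hp', h5⟩ := Finset.mem_filter.mp hp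
    have hp : p.Prime := (Nat.mem_primeFactors.mp hp').1
    have hpr : Prime (p : ℤ) := Nat.prime_iff_prime_int.mp hp
    refine if_congr ⟨fun h => ?_, fun h => ?_⟩ rfl rfl
    · -- `p ∣ A₂ → p ∣ H`
      have h1 : (p : ℤ) ∣ 16 * H := by rw [← hA₀]; exact h.trans hA₂A₀
      rcases hpr.dvd_or_dvd h1 with h | h
      · exact absurd (by simpa using h) (not_dvd_two_pow_mul_three_pow hp h5 4 0)
      · exact h
    · -- `p ∣ H → p ∣ A₂`
      have h1 : (p : ℤ) ∣ k ^ 4 * A₂ := by rw [← hA, hA₀]; exact dvd_mul_of_dvd_right h _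
      rcases hpr.dvd_or_dvd h1 with h | h
      · exact absurd (by rw [hk] at h; simpa [mul_pow, ← pow_mul] using hpr.dvd_of_dvd_pow h)
          (not_dvd_two_pow_mul_three_pow hp h5 s t)
      · exact h
  refine ⟨(s, t), Finset.mem_product.mpr ⟨Finset.mem_range.mpr (by omega), Finset.mem_range.mpr (by omega)⟩,
    (A₂, B₂), hA, hB, hA₂0, hB₂0, ?_, ⟨16 * W, hΔ⟩, ⟨?_, ?_, hTF₃⟩, ?_, ?_, ?_⟩
  · show A₂ ^ 3 ≠ B₂ ^ 2
    intro h
    have h' : A₂ ^ 3 - B₂ ^ 2 = 0 := sub_eq_zero.mpr h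
    rw [hΔ] at h'
    exact mul_ne_zero (by norm_num) (mul_ne_zero (by norm_num) hW0) h'
  · intro p hp hp5 ⟨h4, h6⟩
    refine data_tf_five F hF q hF0 hc5 p hp hp5 ⟨?_, ?_⟩
    · rw [← hA₀]; exact h4.trans hA₂A₀
    · have : (p : ℤ) ^ 6 ∣ B₀ := h6.trans hB₂B₀
      rwa [hB₀, neg_mul, dvd_neg] at this
  · rintro ⟨ha, hb⟩
    exact hTF₂ ⟨ha.trans (Dvd.intro_left _ hA₂.symm), hb.trans (Dvd.intro_left _ hB₂.symm)⟩
  · show 16 * Y / kR ≤ (Mcusp (A₂, B₂) : ℝ)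
    rw [div_le_iff₀ hkR0, hMR]; linarith
  · show (Mcusp (A₂, B₂) : ℝ) < 2 * (16 * Y / kR)
    rw [show 2 * (16 * Y / kR) = (32 * Y) / kR by ring, lt_div_iff₀ hkR0, hMR]; linarith
  · show (N5cusp (A₂, B₂) : ℝ) ≤ X
    rw [hN5]; exact hN

/-- **Registered sub-goal `data_cusp_image`** of stmt-ABC-1975 (stub `stub_ringCensus`): the descaled cusp image of a
datum of a maximal form lies in one of the nine cusp shells `cuspShell X (16Y/(2^s3^t)¹²)`, `s, t ≤ 2`. -/
theorem data_cusp_image : ∀ (F : BinaryCubic ℤ), RingOfForm.IsMaximal F → ∀ (X Y : ℝ) (q : ℤ × ℤ), q ∈ ifShell F X Y → ∃ ij ∈ Finset.range 3 ×ˢ Finset.range 3, ∃ x : ℤ × ℤ, 16 * hessAt F q.1 q.2 = ((2 : ℤ) ^ ij.1 * 3 ^ ij.2) ^ 4 * x.1 ∧ -32 * covAt F q.1 q.2 = ((2 : ℤ) ^ ij.1 * 3 ^ ij.2) ^ 6 * x.2 ∧ x ∈ cuspShell X (16 * Y / ((2 : ℝ) ^ ij.1 * 3 ^ ij.2) ^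 12) :=
  fun _ hF _ _ _ hq => exists_cusp_image hF hq

end Summit.ABC.ABC.Theorems.SharpModerateLaw

end
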